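import Mathlib
import HarnessLib
import Literature.MathematicalPhysics.KineticTheory.HardSphereEulerProofs
import Literature.MathematicalPhysics.KineticTheory.HardSphereEulerLLN
import Summits.AtomisticToContinuum.HydrodynamicLimit.Theses.OneFlightGossipEngine

/-!
# The node `LCT♯` and the scalar bookkeeping of the s-axis net — stub `stub_sAxisNet` of line `Sketch`,
# crux `LocalClampedTransferLDAlongFamilies` (stmt-AtomisticToContinuum-17691)

Route `OneFlightGossipEngine`, sub-problem `HydrodynamicLimit`. This file declares the profile-wise collisional node
`LCTSharp` (LCT♯: the crux's four transfer-clamped, EOS-projected, centred window rows for ONE profile triple and ONE test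
function, with NUMERIC clamp/tilt thresholds `V₀(Θ,U,Λ,Lφ,σ)`, `β₀(Θ,U,Λ,Lφ,σ,V)`; a route-internal `Prop`, the
hypothesis of the registered stub `stub_sAxisNet : LCTSharp → LocalClampedTransferLDAlongFamilies` and the conclusion of
the registered stub `stub_spatialTransfer`), and the scalar lemmas of the net: impulses dominated by the transfer impulse,
the nearest node of the net, the tolerance budgets, and the shape budgets of the one-body modulus.

References: S. Olla, S. R. S. Varadhan, H.-T. Yau, Comm. Math. Phys. 155 (1993) §3; H. Spohn, *Large Scale Dynamics of
Interacting Particles* (1991), Part I §2.3.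
-/

noncomputable section

open MeasureTheory Set Filter
open scoped ENNReal Topology BigOperators

namespace Summit.AtomisticToContinuum.HydrodynamicLimit.Theorems.LocalClampedTransferSketch

open Literature.Analysis.FluidPDE (HardSphereFlow Config localMaxwellian canonicalDensity liouville)
open Literature.MathematicalPhysics.KineticTheory (T3 V3 hsDiameter localGibbsLaw localGibbsProfile rhoLim
  profileOf hsCompressibility)
open Literature.Analysis.FluidPDE Literature.MathematicalPhysics.KineticTheory Literature.Analysis.FunctionSpaces

/-- registered stub signature (hypothesis of S5 `stub_sAxisNet`, conclusion of S6 `stub_spatialTransfer`) of line Sketch,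
crux LocalClampedTransferLDAlongFamilies (stmt-AtomisticToContinuum-17691) — route-internal, not a cited fact.
**LCT♯ — the profile-wise collisional node with NUMERIC clamp/tilt thresholds**: there is a packing guard `η₀ > 0`
such that for all data bounds `(Θ, U, Λ, Lφ)` and every `σ ∈ (0, 1/2)` there are `V₀ = V₀(Θ,U,Λ,Lφ,σ)` and, for
`V ≥ V₀`, `β₀ = β₀(Θ,U,Λ,Lφ,σ,V) > 0` serving EVERY continuous profile triple within the bounds (packing guard by `η₀`),
every flow family and every smooth test function with `|∂φ|, |∂∂φ| ≤ Lφ`: for `|β| ≤ β₀` and `ε > 0` there are `τ₀`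
and, for `τ ≥ τ₀`, `N₀` beyond which the four transfer-clamped, EOS-projected, centred window rows of the crux (its
`let` block verbatim with `a s ↦ a`, `θ₀ s ↦ θ₀`, `u₀ s ↦ u₀`, `φ s ↦ φ`) have exponential moments `≤ e^{ε(N+1)}`
under `localGibbsLaw σ a u₀ θ₀ N (Φ N)`. OPEN (contains the F1/F2 core of TwoClocks' 16623). -/
def LCTSharp : Prop :=
  ∃ η₀ : ℝ, 0 < η₀ ∧ ∀ (Θ U Λ Lφ : ℝ), 1 ≤ Θ → 0 ≤ U → 1 ≤ Λ → 0 ≤ Lφ → ∀ σ : ℝ, 0 < σ → σ < 1 / 2 →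
    ∃ V₀ : ℝ, 0 < V₀ ∧ ∀ V : ℝ, V₀ ≤ V → ∃ β₀ : ℝ, 0 < β₀ ∧
    ∀ (a θ₀ : T3 → ℝ) (u₀ : T3 → V3) (ha : Continuous a), Continuous θ₀ → Continuous u₀ →
    ∀ (ha0 : ∀ x, 0 < a x), (∀ x, 0 < θ₀ x) →
    (∀ x, Λ⁻¹ ≤ a x ∧ a x ≤ Λ) → (∀ x, Θ⁻¹ ≤ θ₀ x ∧ θ₀ x ≤ Θ) → (∀ x, ‖u₀ x‖ ≤ U) →
    σ ^ 3 * (⨆ x, a x) ≤ η₀ * ∫ x, a x →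
    ∀ Φ : (N : ℕ) → HardSphereFlow (Torus.geometry (Fin 3)) (hsDiameter σ N) (N + 1),
    ∀ φ : T3 → ℝ, Torus.IsSmooth φ →
      (∀ (k : Fin 3) x, |Torus.partialDeriv k φ x| ≤ Lφ) →
      (∀ (k l : Fin 3) x, |Torus.partialDeriv k (Torus.partialDeriv l φ) x| ≤ Lφ) →
    ∀ β : ℝ, |β| ≤ β₀ → ∀ ε : ℝ, 0 < ε → ∃ τ₀ : ℝ, 0 < τ₀ ∧ ∀ τ : ℝ, τ₀ ≤ τ →
    ∃ N₀ : ℕ, ∀ N : ℕ, N₀ ≤ N →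
      (let ρ₀ : T3 → ℝ := rhoLim (profileOf a ha ha0) σ
       let w : ℝ := τ * ((N : ℝ) + 1) ^ (-(1 / 3 : ℝ))
       let P := localGibbsLaw σ a u₀ θ₀ N (Φ N)
       let Z : T3 → ℝ := fun x => hsCompressibility (ρ₀ x * σ ^ 3)
       let Z' : T3 → ℝ := fun x => deriv hsCompressibility (ρ₀ x * σ ^ 3)
       let act := fun (i : Fin (N + 1)) z => σ / τ * (Φ N).collisionSum (Set.Ioc 0 w)
         (fun c => if c.fst = i then ‖c.postVel.1 - c.preVel.1‖ + |‖c.postVel.1‖ ^ 2 - ‖c.preVel.1‖ ^ 2| / 2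
           else 0) z
       let ω := fun (i : Fin (N + 1)) z => if act i z ≤ V then (1 : ℝ) else 0
       let Xm := fun (k : Fin 3) z => (Φ N).collisionSum (Set.Ioc 0 w)
         (fun c => ω c.fst z * ω c.snd z * ((φ c.fstPos - φ c.sndPos) * (c.postVel.1 k - c.preVel.1 k)) / 2) z
       let Am := fun (k : Fin 3) z => (∫ r in (0 : ℝ)..w, ∑ i : Fin (N + 1),
           Torus.partialDeriv k φ ((Φ N).flow r z i).1 *
             (θ₀ ((Φ N).flow r z i).1 * (ρ₀ ((Φ N).flow r z i).1 * σ ^ 3) * Z' ((Φ N).flow r z i).1 +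
               (1 / 3) * (Z ((Φ N).flow r z i).1 - 1) * ‖((Φ N).flow r z i).2 - u₀ ((Φ N).flow r z i).1‖ ^ 2)) -
         w * ((N : ℝ) + 1) * ∫ x, ρ₀ x * Torus.partialDeriv k φ x * (θ₀ x * (ρ₀ x * σ ^ 3) * Z' x)
       let Xe := fun z => (Φ N).collisionSum (Set.Ioc 0 w)
         (fun c => ω c.fst z * ω c.snd z *
           ((φ c.fstPos - φ c.sndPos) * ((‖c.postVel.1‖ ^ 2 - ‖c.preVel.1‖ ^ 2) / 2)) / 2) z
       let Ae := fun z => (∫ r in (0 : ℝ)..w, ∑ i : Fin (N + 1),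
           ((∑ l : Fin 3, u₀ ((Φ N).flow r z i).1 l * Torus.partialDeriv l φ ((Φ N).flow r z i).1) *
               (θ₀ ((Φ N).flow r z i).1 * (ρ₀ ((Φ N).flow r z i).1 * σ ^ 3) * Z' ((Φ N).flow r z i).1 +
                 (1 / 3) * (Z ((Φ N).flow r z i).1 - 1) * ‖((Φ N).flow r z i).2 - u₀ ((Φ N).flow r z i).1‖ ^ 2) +
             θ₀ ((Φ N).flow r z i).1 * (Z ((Φ N).flow r z i).1 - 1) *
               (∑ l : Fin 3, Torus.partialDeriv l φ ((Φ N).flow r z i).1 *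
                 (((Φ N).flow r z i).2 - u₀ ((Φ N).flow r z i).1) l))) -
         w * ((N : ℝ) + 1) * ∫ x, ρ₀ x * (∑ l : Fin 3, u₀ x l * Torus.partialDeriv l φ x) *
           (θ₀ x * (ρ₀ x * σ ^ 3) * Z' x)
       (∀ k : Fin 3, ∫⁻ z, ENNReal.ofReal (Real.exp (β * (w⁻¹ * Xm k z - w⁻¹ * Am k z))) ∂P ≤
           ENNReal.ofReal (Real.exp (ε * ((N : ℝ) + 1)))) ∧
         ∫⁻ z, ENNReal.ofReal (Real.exp (β * (w⁻¹ * Xe z - w⁻¹ * Ae z))) ∂P ≤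
           ENNReal.ofReal (Real.exp (ε * ((N : ℝ) + 1))))

/-! ### Small helpers -/

/-- Two-sided bounds with constants at least one: from `M⁻¹ ≤ f ≤ M` get `(max M 1)⁻¹ ≤ f ≤ max M 1`. -/
theorem bounds_max_one {M x : ℝ} (hM : 0 < M) (h : M⁻¹ ≤ x ∧ x ≤ M) : (max M 1)⁻¹ ≤ x ∧ x ≤ max M 1 :=
  ⟨(inv_anti₀ hM (le_max_left M 1)).trans h.1, h.2.trans (le_max_left M 1)⟩

/-- The momentum impulse `v′_k − v_k` is dominated by the transfer impulse. -/
theorem abs_apply_sub_le_transfer (k : Fin 3) (v v' : V3) :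
    |(fun v v' : V3 => v' k - v k) v v'| ≤ ‖v' - v‖ + |‖v'‖ ^ 2 - ‖v‖ ^ 2| / 2 := by
  have h := PiLp.norm_apply_le (v' - v) k
  rw [Real.norm_eq_abs, PiLp.sub_apply] at h
  exact h.trans (le_add_of_nonneg_right (by positivity))

/-- The energy impulse `(‖v′‖² − ‖v‖²)/2` is dominated by the transfer impulse. -/
theorem abs_energy_sub_le_transfer (v v' : V3) :
    |(fun v v' : V3 => (‖v'‖ ^ 2 - ‖v‖ ^ 2) / 2) v v'| ≤ ‖v' - v‖ + |‖v'‖ ^ 2 - ‖v‖ ^ 2| / 2 := by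
  rw [abs_div, abs_two]
  exact le_add_of_nonneg_left (norm_nonneg _)

/-- Components of a `Fin 3 → ℝ`-valued field are within the sup distance. -/
theorem abs_sub_le_of_dist_pi {f g : Fin 3 → ℝ} {e : ℝ} (h : dist f g < e) (k : Fin 3) : |f k - g k| ≤ e :=
  ((Real.dist_eq _ _).symm.le.trans (dist_le_pi_dist f g k)).trans h.le

/-- The nearest node of the net `kδ` to the left of `s′ ∈ [0, t₁]`. -/
theorem exists_node {δ t₁ s' : ℝ} (hδ : 0 < δ) (hs' : s' ∈ Icc 0 t₁) :
    ∃ k : ℕ, (k : ℝ) * δ ≤ s' ∧ s' < k * δ + δ ∧ k ∈ Finset.range (⌈t₁ / δ⌉₊ + 1) := by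
  refine ⟨⌊s' / δ⌋₊, ?_, ?_, ?_⟩
  · have h := Nat.floor_le (div_nonneg hs'.1 hδ.le)
    rwa [le_div_iff₀ hδ] at h
  · have h := Nat.lt_floor_add_one (s' / δ)
    rw [div_lt_iff₀ hδ] at h
    linarith
  · exact Finset.mem_range.2 (Nat.lt_add_one_iff.2 ((Nat.floor_le_ceil _).trans
      (Nat.ceil_le_ceil (div_le_div_of_nonneg_right hs'.2 hδ.le))))

/-- The budget arithmetic of the net: with `ω ≤ ε/(16(4|β|D + 1))` one has `4|β|·ω·D ≤ ε/16` (`D ≥ 0`, `ε > 0`). -/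
theorem budget_le {β ω D ε : ℝ} (hD : 0 ≤ D) (hε : 0 < ε) (hω : ω ≤ ε / (16 * (4 * |β| * D + 1))) :
    4 * |β| * ω * D ≤ ε / 16 := by
  have hA : 0 ≤ 4 * |β| * D := by positivity
  calc 4 * |β| * ω * D = (4 * |β| * D) * ω := by ring
    _ ≤ (4 * |β| * D) * (ε / (16 * (4 * |β| * D + 1))) := mul_le_mul_of_nonneg_left hω hA
    _ = ε / 16 * ((4 * |β| * D) / (4 * |β| * D + 1)) := by field_simp
    _ ≤ ε / 16 * 1 := mul_le_mul_of_nonneg_left ((div_le_one (by positivity)).2 (by linarith)) (by positivity)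
    _ = ε / 16 := mul_one _

/-- Distributing a scalar over a three-term sum of products: `c · Σ_l f_l g_l = Σ_l (c f_l) g_l`. -/
theorem mul_sum_fin_three (c : ℝ) (f g : Fin 3 → ℝ) : c * ∑ l, f l * g l = ∑ l, (c * f l) * g l := by
  rw [Finset.mul_sum]
  exact Finset.sum_congr rfl fun l _ => by ring

/-- Budget of the one-body shape modulus for a momentum row (`r = 0`): the explicit `ω₁ + ω₂‖v‖²` of
`abs_shape_sub_le` is dominated by `ωE₁ + ωE₂‖v‖²`, `E₁ = 1 + 2U² + Q(1 + 2U) + 3(1 + U + R)`, `E₂ = 2 + Q + 3`. -/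
theorem mom_shape_budget {ω U Q R v2 : ℝ} (hω : 0 ≤ ω) (hU : 0 ≤ U) (hR : 0 ≤ R) (hv : 0 ≤ v2) :
    (ω + 2 * ω * U ^ 2 + Q * ω * (1 + 2 * U) + 3 * (0 * (1 + U) + 0 * ω)) + (2 * ω + Q * ω + 3 * 0) * v2 ≤
      ω * (1 + 2 * U ^ 2 + Q * (1 + 2 * U) + 3 * ((1 + U) + R)) + (ω * (2 + Q + 3)) * v2 := by
  have e : ω * (1 + 2 * U ^ 2 + Q * (1 + 2 * U) + 3 * ((1 + U) + R)) + (ω * (2 + Q + 3)) * v2 -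
      ((ω + 2 * ω * U ^ 2 + Q * ω * (1 + 2 * U) + 3 * (0 * (1 + U) + 0 * ω)) + (2 * ω + Q * ω + 3 * 0) * v2) =
      3 * ω * ((1 + U) + R) + 3 * ω * v2 := by ring
  nlinarith [mul_nonneg hω (add_nonneg (add_nonneg zero_le_one hU) hR), mul_nonneg hω hv]

/-- Budget of the one-body shape modulus for the energy row (all moduli equal to `ω`): an identity. -/
theorem en_shape_budget (ω U Q R v2 : ℝ) :
    (ω + 2 * ω * U ^ 2 + Q * ω * (1 + 2 * U) + 3 * (ω * (1 + U) + R * ω)) + (2 * ω + Q * ω + 3 * ω) * v2 ≤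
      ω * (1 + 2 * U ^ 2 + Q * (1 + 2 * U) + 3 * ((1 + U) + R)) + (ω * (2 + Q + 3)) * v2 :=
  le_of_eq (by ring)

/-- `|T·A − T·B| ≤ ω·T` from `|A − B| ≤ ω` and `T ≥ 0`. -/
theorem abs_mul_sub_mul_le {T A B ω : ℝ} (hT : 0 ≤ T) (h : |A - B| ≤ ω) : |T * A - T * B| ≤ ω * T := by
  rw [← mul_sub, abs_mul, abs_of_nonneg hT, mul_comm]
  exact mul_le_mul_of_nonneg_right h hT

/-- **Registered node prelim of stub `stub_sAxisNet`** (line `Sketch`, crux `LocalClampedTransferLDAlongFamilies`): the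
nearest node `kδ` of the net to the left of a parameter `s′ ∈ [0, t₁]`. -/
theorem stub_sAxisNetNode :
    ∀ (δ t₁ s' : ℝ), 0 < δ → s' ∈ Set.Icc 0 t₁ →
      ∃ k : ℕ, (k : ℝ) * δ ≤ s' ∧ s' < k * δ + δ ∧ k ∈ Finset.range (⌈t₁ / δ⌉₊ + 1) :=
  fun _ _ _ hδ hs' => exists_node hδ hs'

end Summit.AtomisticToContinuum.HydrodynamicLimit.Theorems.LocalClampedTransferSketch

end
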